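import Summits.CriticalPhenomena.PercolationContinuityZ3.Theorems.PercNearOneGluingNoHeavyLowerTailIncStarWDOMTargetCutCore
import Summits.CriticalPhenomena.PercolationContinuityZ3.Theorems.PercNearOneGluingNoHeavyLowerTailIncStarBridgeEvents
import Summits.CriticalPhenomena.PercolationContinuityZ3.Theorems.PercNearOneGluingNoHeavyLowerTailIncStarRootEdgeInduction
import Summits.CriticalPhenomena.PercolationContinuityZ3.Theorems.PercNearOneGluingNoHeavyLowerTailIncStarPkCriterion
import HarnessLib

/-!
# W-domination across a TARGET CUT, II: THEOREM K (Sahi programme, prover prim-sahi-p2 gen 37: "Theorem K")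

Support file (`--supports stmt-CriticalPhenomena-4575`).  No definitions, no named facts, no sorries; standard axioms.  Memo
`run/shared/lean/prim/prim-sahi/FROM-prim-sahi-p2-gen37-TARGET-CUT-PKB.md` §1, `prim-sahi-p2/PROOF-E3.md` §47.

**Setting.**  Product Bernoulli bond percolation `prodBernoulli w` on `Fin n`; a root side `R ∋ s` and the two TARGETS `i, j ∉ R` separate
`R` from the rest: no pair of positive weight joins `R` to a vertex outside `R ∪ {i, j}` (the root gadget `G[R ∪ {i,j}]` and the far graph
`G[Rᶜ]` are arbitrary).  With `B_v = {s ↔ v}`, `q_v = P(B_v)`, `q_{ij} = P(B_i ∩ B_j)` and the statistic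
`W = 2·1_{B_i ∩ B_j} − q_i 1_{B_j} − q_j 1_{B_i}` of the W-domination conjecture (memo gen 34):

* `wdom_targetCut` — **THEOREM K**: for every up-closed family `𝒜` of vertex sets and `A = {ω | C_s(ω) ∩ Rᶜ ∈ 𝒜}` (an arbitrary increasing
  event of the FAR part of the cluster), `2P(A ∩ B_i ∩ B_j) − q_jP(A ∩ B_i) − q_iP(A ∩ B_j) − (2q_{ij} − 2q_iq_j)P(A) ≥ 0`.
  The two-pronged theorem `wdom_twoPronged` (gen 34) is the case `R = {s}`.  Proof: the two-cut dictionary of `…IncStarOneTargetSideEvents`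
  (`s ↔ a ⟺ (s ~_F i ∧ i ↔ a in Rᶜ) ∨ (s ~_F j ∧ j ↔ a in Rᶜ)`), independence of the two sides, and THREE Harris inequalities inside `Rᶜ`
  against the reference probability `ℓ = P(C_i^{Rᶜ} ∪ C_j^{Rᶜ} ∈ 𝒜)`; the lower bound collapses to `ℓ·(2q_{ij} − 2q_iq_j)·P(s ↮_F i, s ↮_F j) ≥ 0`
  (`targetCut_core`, part I `…IncStarWDOMTargetCutCore`).
* `pk_of_targetCut` — the instance `𝒜 = {S | k ∈ S}`: the (P_k) margin `G_k = 2q_{ijk} + 2q_iq_jq_k − q_jq_{ik} − q_iq_{jk} − 2q_kq_{ij} ≥ 0`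
  for every `k` separated from `s` by `{i, j}`;
* `incStar_nonneg_of_targetCut` — hence Sahi's increasing star `E₃({s↔i},{s↔j},{s↔k}) ≥ 0` for such `k` (via `incStar_nonneg_of_pk`, p632715).
-/

noncomputable section

namespace Summit.CriticalPhenomena.PercolationContinuityZ3.Theorems

namespace IncStar

open MeasureTheory Set Literature.Probability.Percolation Literature.Probability.LatticeModels IncStarOneTargetSide
open scoped Classical

variable {n : ℕ}

set_option maxHeartbeats 800000 in
/-- **THEOREM K — W-domination across a target cut.**  Let `R ∋ s` be a root side with `i, j ∉ R` and no pair of positive weight from `R`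
to the outside of `R ∪ {i, j}`.  Then for every up-closed family `𝒜` of vertex sets, with `A = {ω | C_s(ω) ∩ Rᶜ ∈ 𝒜}`, `B_v = {s ↔ v}`,
`q_v = P(B_v)`, `q_{ij} = P(B_i ∩ B_j)`:
`2·P(A ∩ B_i ∩ B_j) − q_j·P(A ∩ B_i) − q_i·P(A ∩ B_j) − (2q_{ij} − 2q_iq_j)·P(A) ≥ 0`. [this work] -/
theorem wdom_targetCut (w : Sym2 (Fin n) → unitInterval) (R : Set (Fin n)) {s i j : Fin n}
    (hs : s ∈ R) (hi : i ∉ R) (hj : j ∉ R)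
    (hw : ∀ x ∈ R, ∀ z, z ∉ R → z ≠ i → z ≠ j → w s(x, z) = 0)
    (𝒜 : Set (Set (Fin n))) (h𝒜 : ∀ S T : Set (Fin n), S ∈ 𝒜 → S ⊆ T → T ∈ 𝒜) :
    0 ≤ 2 * (prodBernoulli w).real ({ω | openCluster ω s ∩ Rᶜ ∈ 𝒜} ∩ openConn s i ∩ openConn s j)
        - (prodBernoulli w).real (openConn s j) * (prodBernoulli w).real ({ω | openCluster ω s ∩ Rᶜ ∈ 𝒜} ∩ openConn s i)
        - (prodBernoulli w).real (openConn s i) * (prodBernoulli w).real ({ω | openCluster ω s ∩ Rᶜ ∈ 𝒜} ∩ openConn s j)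
        - (2 * (prodBernoulli w).real (openConn s i ∩ openConn s j)
            - 2 * ((prodBernoulli w).real (openConn s i) * (prodBernoulli w).real (openConn s j)))
          * (prodBernoulli w).real {ω | openCluster ω s ∩ Rᶜ ∈ 𝒜} := by
  have hm : ∀ X : Set (BondConfig (Fin n)), MeasurableSet X := fun _ => MeasurableSet.of_discrete
  set A : Set (BondConfig (Fin n)) := {ω | openCluster ω s ∩ Rᶜ ∈ 𝒜} with hA
  set Bi : Set (BondConfig (Fin n)) := openConn s i with hBi
  set Bj : Set (BondConfig (Fin n)) := openConn s j with hBj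
  -- Harris for the two connections (EW ≥ 0) and the trivial case `∅ ∈ 𝒜`
  have hEW0 : (prodBernoulli w).real Bi * (prodBernoulli w).real Bj ≤ (prodBernoulli w).real (Bi ∩ Bj) :=
    prodBernoulli_harris w (isUpperSet_openConn s i) (isUpperSet_openConn s j) (hm _) (hm _)
  by_cases hbot : (∅ : Set (Fin n)) ∈ 𝒜
  · have hAu : A = Set.univ := by
      ext ω; simp only [hA, Set.mem_setOf_eq, Set.mem_univ, iff_true]
      exact h𝒜 _ _ hbot (Set.empty_subset _)
    rw [hAu]
    simp only [Set.univ_inter, probReal_univ, mul_one]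
    nlinarith [mul_comm ((prodBernoulli w).real Bj) ((prodBernoulli w).real Bi)]
  -- vocabulary of the two-cut dictionary
  set F : Set (Sym2 (Fin n)) := {e : Sym2 (Fin n) | ∃ y ∈ R, y ∈ e} with hF
  set Xu : Set (BondConfig (Fin n)) := {ω | ω ∩ F ∈ (openConn s i : Set (BondConfig (Fin n)))} with hXu
  set Xv : Set (BondConfig (Fin n)) := {ω | ω ∩ F ∈ (openConn s j : Set (BondConfig (Fin n)))} with hXv
  set Z : Set (BondConfig (Fin n)) := openConnIn Rᶜ i j with hZ
  set Cu : BondConfig (Fin n) → Set (Fin n) := fun ω => {a | ω ∈ openConnIn Rᶜ i a} with hCu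
  set Cv : BondConfig (Fin n) → Set (Fin n) := fun ω => {a | ω ∈ openConnIn Rᶜ j a} with hCv
  set Eb : Set (BondConfig (Fin n)) := {ω | Cu ω ∪ Cv ω ∈ 𝒜} with hEb
  set Eu : Set (BondConfig (Fin n)) := {ω | Cu ω ∈ 𝒜} with hEu
  set Ev : Set (BondConfig (Fin n)) := {ω | Cv ω ∈ 𝒜} with hEv
  have Cu_mono : ∀ {ω ω' : BondConfig (Fin n)}, ω ≤ ω' → Cu ω ⊆ Cu ω' :=
    fun hle a ha => isUpperSet_openConnIn Rᶜ i a hle ha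
  have Cv_mono : ∀ {ω ω' : BondConfig (Fin n)}, ω ≤ ω' → Cv ω ⊆ Cv ω' :=
    fun hle a ha => isUpperSet_openConnIn Rᶜ j a hle ha
  have hEb_up : IsUpperSet Eb := fun ω ω' hle h => h𝒜 _ _ h (Set.union_subset_union (Cu_mono hle) (Cv_mono hle))
  have hEu_up : IsUpperSet Eu := fun ω ω' hle h => h𝒜 _ _ h (Cu_mono hle)
  have hEv_up : IsUpperSet Ev := fun ω ω' hle h => h𝒜 _ _ h (Cv_mono hle)
  have hZ_up : IsUpperSet Z := isUpperSet_openConnIn Rᶜ i j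
  have hEuEb : Eu ⊆ Eb := fun ω h => h𝒜 _ _ h Set.subset_union_left
  have hEvEb : Ev ⊆ Eb := fun ω h => h𝒜 _ _ h Set.subset_union_right
  -- under `Z` the two far clusters coincide
  have hZuv : ∀ ω ∈ Z, Cv ω ⊆ Cu ω := fun ω hz a ha => (outside_ports_facts Rᶜ i j a ω).2.2 hz ha
  have hZvu : ∀ ω ∈ Z, Cu ω ⊆ Cv ω := fun ω hz a ha => (outside_ports_facts Rᶜ i j a ω).2.1 hz ha
  have hZ_Eu : ∀ ω ∈ Z, (ω ∈ Eu ↔ ω ∈ Eb) := fun ω hz => by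
    have e : Cu ω ∪ Cv ω = Cu ω := Set.union_eq_left.2 (hZuv ω hz)
    show Cu ω ∈ 𝒜 ↔ Cu ω ∪ Cv ω ∈ 𝒜
    rw [e]
  have hZ_Ev : ∀ ω ∈ Z, (ω ∈ Ev ↔ ω ∈ Eb) := fun ω hz => by
    have e : Cu ω ∪ Cv ω = Cv ω := Set.union_eq_right.2 (hZvu ω hz)
    show Cv ω ∈ 𝒜 ↔ Cu ω ∪ Cv ω ∈ 𝒜
    rw [e]
  -- the sure set and the dictionary
  set G : Set (BondConfig (Fin n)) := {ω | ∀ e, w e = 0 → e ∉ ω} with hG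
  have hG1 : (prodBernoulli w).real G = 1 := IncStar.real_sureClosed w
  have hGω : ∀ ω ∈ G, ∀ x ∈ R, ∀ z, z ∉ R → z ≠ i → z ≠ j → s(x, z) ∉ ω :=
    fun ω hω x hx z hz hzi hzj => hω _ (hw x hx z hz hzi hzj)
  have hii : ∀ ω : BondConfig (Fin n), ω ∈ openConnIn Rᶜ i i := fun ω => openConnIn_refl hi
  have hjj : ∀ ω : BondConfig (Fin n), ω ∈ openConnIn Rᶜ j j := fun ω => openConnIn_refl hj
  have hZ' : ∀ ω : BondConfig (Fin n), ω ∈ openConnIn Rᶜ j i ↔ ω ∈ Z := fun ω => by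
    rw [hZ, openConnIn_comm Rᶜ i j]
  have dBi : ∀ ω ∈ G, (ω ∈ Bi ↔ ω ∈ Xu ∨ (ω ∈ Xv ∧ ω ∈ Z)) := fun ω hω => by
    rw [hBi, twoCut_conn_outside_iff hs (hGω ω hω) hi]
    exact ⟨fun h => h.elim (fun h1 => Or.inl h1.1) (fun h2 => Or.inr ⟨h2.1, (hZ' ω).1 h2.2⟩),
      fun h => h.elim (fun hu => Or.inl ⟨hu, hii ω⟩) (fun hvz => Or.inr ⟨hvz.1, (hZ' ω).2 hvz.2⟩)⟩
  have dBj : ∀ ω ∈ G, (ω ∈ Bj ↔ ω ∈ Xv ∨ (ω ∈ Xu ∧ ω ∈ Z)) := fun ω hω => by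
    rw [hBj, twoCut_conn_outside_iff hs (hGω ω hω) hj]
    exact ⟨fun h => h.elim (fun h1 => Or.inr ⟨h1.1, h1.2⟩) (fun h2 => Or.inl h2.1),
      fun h => h.elim (fun hv => Or.inr ⟨hv, hjj ω⟩) (fun huz => Or.inl ⟨huz.1, huz.2⟩)⟩
  have dC : ∀ ω ∈ G, ∀ a : Fin n, (a ∈ openCluster ω s ∩ Rᶜ ↔ (ω ∈ Xu ∧ a ∈ Cu ω) ∨ (ω ∈ Xv ∧ a ∈ Cv ω)) := by
    intro ω hω a
    by_cases ha : a ∈ R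
    · constructor
      · rintro ⟨-, h⟩; exact absurd ha h
      · rintro (⟨-, h⟩ | ⟨-, h⟩)
        · obtain ⟨-, h2, -⟩ := h; exact absurd ha h2
        · obtain ⟨-, h2, -⟩ := h; exact absurd ha h2
    · have e1 : a ∈ openCluster ω s ↔ ω ∈ (openConn s a : Set (BondConfig (Fin n))) := Iff.rfl
      rw [Set.mem_inter_iff, e1, twoCut_conn_outside_iff hs (hGω ω hω) ha]
      exact ⟨fun h => h.1.elim (fun h1 => Or.inl ⟨h1.1, h1.2⟩) (fun h2 => Or.inr ⟨h2.1, h2.2⟩),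
        fun h => ⟨h.elim (fun h1 => Or.inl ⟨h1.1, h1.2⟩) (fun h2 => Or.inr ⟨h2.1, h2.2⟩), ha⟩⟩
  -- the far part of the cluster in the four far types
  have cl11 : ∀ ω ∈ G, ω ∈ Xu → ω ∈ Xv → openCluster ω s ∩ Rᶜ = Cu ω ∪ Cv ω := fun ω hω hu hv => by
    ext a; rw [dC ω hω a, Set.mem_union]
    exact ⟨fun h => h.elim (fun h => Or.inl h.2) (fun h => Or.inr h.2), fun h => h.elim (fun h => Or.inl ⟨hu, h⟩) (fun h => Or.inr ⟨hv, h⟩)⟩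
  have cl10 : ∀ ω ∈ G, ω ∈ Xu → ω ∉ Xv → openCluster ω s ∩ Rᶜ = Cu ω := fun ω hω hu hv => by
    ext a; rw [dC ω hω a]
    exact ⟨fun h => h.elim (fun h => h.2) (fun h => absurd h.1 hv), fun h => Or.inl ⟨hu, h⟩⟩
  have cl01 : ∀ ω ∈ G, ω ∉ Xu → ω ∈ Xv → openCluster ω s ∩ Rᶜ = Cv ω := fun ω hω hu hv => by
    ext a; rw [dC ω hω a]
    exact ⟨fun h => h.elim (fun h => absurd h.1 hu) (fun h => h.2), fun h => Or.inr ⟨hv, h⟩⟩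
  have cl00 : ∀ ω ∈ G, ω ∉ Xu → ω ∉ Xv → openCluster ω s ∩ Rᶜ = ∅ := fun ω hω hu hv => by
    ext a; rw [dC ω hω a, Set.mem_empty_iff_false]
    exact ⟨fun h => h.elim (fun h => hu h.1) (fun h => hv h.1), fun h => h.elim⟩
  have hAmem : ∀ ω : BondConfig (Fin n), ω ∈ A ↔ openCluster ω s ∩ Rᶜ ∈ 𝒜 := fun ω => Iff.rfl
  have hEbmem : ∀ ω : BondConfig (Fin n), ω ∈ Eb ↔ Cu ω ∪ Cv ω ∈ 𝒜 := fun ω => Iff.rfl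
  have hEumem : ∀ ω : BondConfig (Fin n), ω ∈ Eu ↔ Cu ω ∈ 𝒜 := fun ω => Iff.rfl
  have hEvmem : ∀ ω : BondConfig (Fin n), ω ∈ Ev ↔ Cv ω ∈ 𝒜 := fun ω => Iff.rfl
  -- the three cells on the sure set
  have cBoth : ∀ ω ∈ G, (ω ∈ A ∩ Bi ∩ Bj ↔ ω ∈ (Xu ∩ Xv ∩ Eb) ∪ (((Xu \ Xv) ∪ (Xv \ Xu)) ∩ (Z ∩ Eb))) := by
    intro ω hω
    have h1 := dBi ω hω; have h2 := dBj ω hω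
    by_cases hu : ω ∈ Xu <;> by_cases hv : ω ∈ Xv
    · have e := cl11 ω hω hu hv
      refine ⟨fun h => Or.inl ⟨⟨hu, hv⟩, ?_⟩, fun h => ?_⟩
      · have hAω : openCluster ω s ∩ Rᶜ ∈ 𝒜 := h.1.1
        rw [e] at hAω; exact hAω
      · have hEbω : ω ∈ Eb := h.elim (fun h => h.2) (fun h => h.2.2)
        have hAω : openCluster ω s ∩ Rᶜ ∈ 𝒜 := by rw [e]; exact hEbω
        exact ⟨⟨hAω, h1.2 (Or.inl hu)⟩, h2.2 (Or.inl hv)⟩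
    · have e := cl10 ω hω hu hv
      refine ⟨fun h => ?_, fun h => ?_⟩
      · have hz : ω ∈ Z := ((h2.1 h.2).resolve_left hv).2
        have hAω : openCluster ω s ∩ Rᶜ ∈ 𝒜 := h.1.1
        rw [e] at hAω
        exact Or.inr ⟨Or.inl ⟨hu, hv⟩, hz, (hZ_Eu ω hz).1 hAω⟩
      · rcases h with h | h
        · exact absurd h.1.2 hv
        · have hz : ω ∈ Z := h.2.1
          have hAω : openCluster ω s ∩ Rᶜ ∈ 𝒜 := by rw [e]; exact (hZ_Eu ω hz).2 h.2.2
          exact ⟨⟨hAω, h1.2 (Or.inl hu)⟩, h2.2 (Or.inr ⟨hu, hz⟩)⟩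
    · have e := cl01 ω hω hu hv
      refine ⟨fun h => ?_, fun h => ?_⟩
      · have hz : ω ∈ Z := ((h1.1 h.1.2).resolve_left hu).2
        have hAω : openCluster ω s ∩ Rᶜ ∈ 𝒜 := h.1.1
        rw [e] at hAω
        exact Or.inr ⟨Or.inr ⟨hv, hu⟩, hz, (hZ_Ev ω hz).1 hAω⟩
      · rcases h with h | h
        · exact absurd h.1.1 hu
        · have hz : ω ∈ Z := h.2.1
          have hAω : openCluster ω s ∩ Rᶜ ∈ 𝒜 := by rw [e]; exact (hZ_Ev ω hz).2 h.2.2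
          exact ⟨⟨hAω, h1.2 (Or.inr ⟨hv, hz⟩)⟩, h2.2 (Or.inl hv)⟩
    · refine ⟨fun h => ?_, fun h => ?_⟩
      · rcases h1.1 h.1.2 with h' | h'
        · exact absurd h' hu
        · exact absurd h'.1 hv
      · rcases h with h | h
        · exact absurd h.1.1 hu
        · rcases h.1 with h' | h'
          · exact absurd h'.1 hu
          · exact absurd h'.1 hv
  have cIo : ∀ ω ∈ G, (ω ∈ A ∩ Bi ∩ Bjᶜ ↔ ω ∈ (Xu \ Xv) ∩ (Eu ∩ Zᶜ)) := by
    intro ω hω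
    have h1 := dBi ω hω; have h2 := dBj ω hω
    refine ⟨fun h => ?_, fun h => ?_⟩
    · have hBj : ω ∉ Bj := h.2
      have hv : ω ∉ Xv := fun hv => hBj (h2.2 (Or.inl hv))
      have hu : ω ∈ Xu := (h1.1 h.1.2).elim id (fun h' => absurd h'.1 hv)
      have hz : ω ∉ Z := fun hz => hBj (h2.2 (Or.inr ⟨hu, hz⟩))
      have hAω : openCluster ω s ∩ Rᶜ ∈ 𝒜 := h.1.1
      rw [cl10 ω hω hu hv] at hAω
      exact ⟨⟨hu, hv⟩, hAω, hz⟩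
    · have hu : ω ∈ Xu := h.1.1
      have hv : ω ∉ Xv := h.1.2
      have hz : ω ∉ Z := h.2.2
      have hAω : openCluster ω s ∩ Rᶜ ∈ 𝒜 := by rw [cl10 ω hω hu hv]; exact h.2.1
      refine ⟨⟨hAω, h1.2 (Or.inl hu)⟩, fun hBj => ?_⟩
      rcases h2.1 hBj with h' | h'
      · exact hv h'
      · exact hz h'.2
  have cJo : ∀ ω ∈ G, (ω ∈ A ∩ Bj ∩ Biᶜ ↔ ω ∈ (Xv \ Xu) ∩ (Ev ∩ Zᶜ)) := by
    intro ω hω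
    have h1 := dBi ω hω; have h2 := dBj ω hω
    refine ⟨fun h => ?_, fun h => ?_⟩
    · have hBi : ω ∉ Bi := h.2
      have hu : ω ∉ Xu := fun hu => hBi (h1.2 (Or.inl hu))
      have hv : ω ∈ Xv := (h2.1 h.1.2).elim id (fun h' => absurd h'.1 hu)
      have hz : ω ∉ Z := fun hz => hBi (h1.2 (Or.inr ⟨hv, hz⟩))
      have hAω : openCluster ω s ∩ Rᶜ ∈ 𝒜 := h.1.1
      rw [cl01 ω hω hu hv] at hAω
      exact ⟨⟨hv, hu⟩, hAω, hz⟩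
    · have hv : ω ∈ Xv := h.1.1
      have hu : ω ∉ Xu := h.1.2
      have hz : ω ∉ Z := h.2.2
      have hAω : openCluster ω s ∩ Rᶜ ∈ 𝒜 := by rw [cl01 ω hω hu hv]; exact h.2.1
      refine ⟨⟨hAω, h2.2 (Or.inl hv)⟩, fun hBi => ?_⟩
      rcases h1.1 hBi with h' | h'
      · exact hu h'
      · exact hz h'.2
  have cNone : ∀ ω ∈ G, (ω ∈ A ∩ Biᶜ ∩ Bjᶜ ↔ ω ∈ (∅ : Set (BondConfig (Fin n)))) := by
    intro ω hω
    have h1 := dBi ω hω; have h2 := dBj ω hω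
    refine ⟨fun h => ?_, fun h => h.elim⟩
    have hBi : ω ∉ Bi := h.1.2
    have hBj : ω ∉ Bj := h.2
    have hu : ω ∉ Xu := fun hu => hBi (h1.2 (Or.inl hu))
    have hv : ω ∉ Xv := fun hv => hBj (h2.2 (Or.inl hv))
    have hAω : openCluster ω s ∩ Rᶜ ∈ 𝒜 := h.1.1
    rw [cl00 ω hω hu hv] at hAω
    exact hbot hAω
  have dF : ∀ p q : Fin n, DeterminedBy {ω : BondConfig (Fin n) | ω ∩ F ∈ (openConn p q : Set (BondConfig (Fin n)))} F :=
    fun p q => SahiRootSide.determinedBy_rootSide R p q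
  have dXu : DeterminedBy Xu F := dF s i
  have dXv : DeterminedBy Xv F := dF s j
  have dZ : DeterminedBy Z Fᶜ := SahiRootSide.determinedBy_openConnIn_compl R i j
  have dCu : ∀ ω ω' : BondConfig (Fin n), ω ∩ Fᶜ = ω' ∩ Fᶜ → Cu ω = Cu ω' := fun ω ω' h => by
    ext a
    exact (determinedBy_iff _ _).1 (SahiRootSide.determinedBy_openConnIn_compl R i a) ω ω' h
  have dCv : ∀ ω ω' : BondConfig (Fin n), ω ∩ Fᶜ = ω' ∩ Fᶜ → Cv ω = Cv ω' := fun ω ω' h => by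
    ext a
    exact (determinedBy_iff _ _).1 (SahiRootSide.determinedBy_openConnIn_compl R j a) ω ω' h
  have dEb : DeterminedBy Eb Fᶜ := (determinedBy_iff _ _).2 fun ω ω' h => by
    rw [hEbmem, hEbmem, dCu ω ω' h, dCv ω ω' h]
  have dEu : DeterminedBy Eu Fᶜ := (determinedBy_iff _ _).2 fun ω ω' h => by
    rw [hEumem, hEumem, dCu ω ω' h]
  have dEv : DeterminedBy Ev Fᶜ := (determinedBy_iff _ _).2 fun ω ω' h => by
    rw [hEvmem, hEvmem, dCv ω ω' h]
  have dXuv : DeterminedBy (Xu ∩ Xv) F := dXu.inter dXv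
  have dXor : DeterminedBy ((Xu \ Xv) ∪ (Xv \ Xu)) F :=
    (determinedBy_union_sdiff (determinedBy_union_sdiff dXu dXv).2 (determinedBy_union_sdiff dXv dXu).2).1
  have dZc : DeterminedBy Zᶜ Fᶜ := by
    have h := (determinedBy_union_sdiff (determinedBy_univ Fᶜ) dZ).2
    rwa [← Set.compl_eq_univ_sdiff] at h
  set α : ℝ := (prodBernoulli w).real (Xu ∩ Xv) with hα
  set β₁ : ℝ := (prodBernoulli w).real (Xu \ Xv) with hβ₁
  set β₂ : ℝ := (prodBernoulli w).real (Xv \ Xu) with hβ₂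
  set ζ : ℝ := (prodBernoulli w).real Z with hζ
  set ℓ : ℝ := (prodBernoulli w).real Eb with hℓ
  have hα0 : 0 ≤ α := measureReal_nonneg
  have hβ₁0 : 0 ≤ β₁ := measureReal_nonneg
  have hβ₂0 : 0 ≤ β₂ := measureReal_nonneg
  have hζ0 : 0 ≤ ζ := measureReal_nonneg
  have hζ1 : ζ ≤ 1 := measureReal_le_one
  have hℓ0 : 0 ≤ ℓ := measureReal_nonneg
  have hXu_split : (prodBernoulli w).real Xu = α + β₁ := real_split w Xu Xv
  have hXv_split : (prodBernoulli w).real Xv = α + β₂ := by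
    have e : Xv ∩ Xuᶜ = Xv \ Xu := rfl
    rw [real_split w Xv Xu, Set.inter_comm, e]
  have dj1 : Disjoint (Xu \ Xv) (Xv \ Xu) := Set.disjoint_left.2 fun ω h h' => h.2 h'.1
  have hxor : (prodBernoulli w).real ((Xu \ Xv) ∪ (Xv \ Xu)) = β₁ + β₂ := by
    rw [hβ₁, hβ₂, measureReal_union dj1 (hm _)]
  have hsum : α + β₁ + β₂ ≤ 1 := by
    have dj : Disjoint Xu (Xv \ Xu) := Set.disjoint_left.2 fun ω h h' => h'.2 h
    have h1 : (prodBernoulli w).real (Xu ∪ (Xv \ Xu)) = (prodBernoulli w).real Xu + β₂ := by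
      rw [hβ₂, measureReal_union dj (hm _)]
    have h2 : (prodBernoulli w).real (Xu ∪ (Xv \ Xu)) ≤ 1 := measureReal_le_one
    linarith
  have hqi : (prodBernoulli w).real Bi = α + β₁ + β₂ * ζ := by
    have e : (prodBernoulli w).real Bi = (prodBernoulli w).real (Xu ∪ ((Xv \ Xu) ∩ Z)) := by
      refine real_congr_of_sure hG1 fun ω hω => ?_
      rw [dBi ω hω]
      refine ⟨fun h => h.elim (fun hu => Or.inl hu) (fun h' => ?_), fun h => h.elim (fun hu => Or.inl hu) (fun h' => Or.inr ⟨h'.1.1, h'.2⟩)⟩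
      by_cases hu : ω ∈ Xu
      · exact Or.inl hu
      · exact Or.inr ⟨⟨h'.1, hu⟩, h'.2⟩
    have dj : Disjoint Xu ((Xv \ Xu) ∩ Z) := Set.disjoint_left.2 fun ω h h' => h'.1.2 h
    rw [e, measureReal_union dj (hm _), hXu_split, indep_far_near w R (determinedBy_union_sdiff dXv dXu).2 dZ]
  have hqj : (prodBernoulli w).real Bj = α + β₂ + β₁ * ζ := by
    have e : (prodBernoulli w).real Bj = (prodBernoulli w).real (Xv ∪ ((Xu \ Xv) ∩ Z)) := by
      refine real_congr_of_sure hG1 fun ω hω => ?_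
      rw [dBj ω hω]
      refine ⟨fun h => h.elim (fun hv => Or.inl hv) (fun h' => ?_), fun h => h.elim (fun hv => Or.inl hv) (fun h' => Or.inr ⟨h'.1.1, h'.2⟩)⟩
      by_cases hv : ω ∈ Xv
      · exact Or.inl hv
      · exact Or.inr ⟨⟨h'.1, hv⟩, h'.2⟩
    have dj : Disjoint Xv ((Xu \ Xv) ∩ Z) := Set.disjoint_left.2 fun ω h h' => h'.1.2 h
    rw [e, measureReal_union dj (hm _), hXv_split, indep_far_near w R (determinedBy_union_sdiff dXu dXv).2 dZ]
  have hqij : (prodBernoulli w).real (Bi ∩ Bj) = α + (β₁ + β₂) * ζ := by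
    have e : (prodBernoulli w).real (Bi ∩ Bj) = (prodBernoulli w).real ((Xu ∩ Xv) ∪ (((Xu \ Xv) ∪ (Xv \ Xu)) ∩ Z)) := by
      refine real_congr_of_sure hG1 fun ω hω => ?_
      have h1 := dBi ω hω; have h2 := dBj ω hω
      refine ⟨fun h => ?_, fun h => ?_⟩
      · by_cases hu : ω ∈ Xu <;> by_cases hv : ω ∈ Xv
        · exact Or.inl ⟨hu, hv⟩
        · exact Or.inr ⟨Or.inl ⟨hu, hv⟩, ((h2.1 h.2).resolve_left hv).2⟩
        · exact Or.inr ⟨Or.inr ⟨hv, hu⟩, ((h1.1 h.1).resolve_left hu).2⟩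
        · exact absurd ((h1.1 h.1).resolve_left hu).1 hv
      · rcases h with h | h
        · exact ⟨h1.2 (Or.inl h.1), h2.2 (Or.inl h.2)⟩
        · rcases h.1 with h' | h'
          · exact ⟨h1.2 (Or.inl h'.1), h2.2 (Or.inr ⟨h'.1, h.2⟩)⟩
          · exact ⟨h1.2 (Or.inr ⟨h'.1, h.2⟩), h2.2 (Or.inl h'.1)⟩
    have dj : Disjoint (Xu ∩ Xv) (((Xu \ Xv) ∪ (Xv \ Xu)) ∩ Z) := Set.disjoint_left.2 fun ω h h' => by
      rcases h'.1 with h' | h'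
      · exact h'.2 h.2
      · exact h'.2 h.1
    rw [e, measureReal_union dj (hm _), ← hα, indep_far_near w R dXor dZ, hxor]
  have hPb : (α + (β₁ + β₂) * ζ) * ℓ ≤ (prodBernoulli w).real (A ∩ Bi ∩ Bj) := by
    have e : (prodBernoulli w).real (A ∩ Bi ∩ Bj)
        = (prodBernoulli w).real ((Xu ∩ Xv ∩ Eb) ∪ (((Xu \ Xv) ∪ (Xv \ Xu)) ∩ (Z ∩ Eb))) := real_congr_of_sure hG1 cBoth
    have dj : Disjoint (Xu ∩ Xv ∩ Eb) (((Xu \ Xv) ∪ (Xv \ Xu)) ∩ (Z ∩ Eb)) := Set.disjoint_left.2 fun ω h h' => by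
      rcases h'.1 with h' | h'
      · exact h'.2 h.1.2
      · exact h'.2 h.1.1
    rw [e, measureReal_union dj (hm _), indep_far_near w R dXuv dEb, indep_far_near w R dXor (dZ.inter dEb), hxor]
    have hH : ζ * ℓ ≤ (prodBernoulli w).real (Z ∩ Eb) := prodBernoulli_harris w hZ_up hEb_up (hm _) (hm _)
    nlinarith
  have hPio : (prodBernoulli w).real (A ∩ Bi ∩ Bjᶜ) ≤ β₁ * (1 - ζ) * ℓ := by
    have e : (prodBernoulli w).real (A ∩ Bi ∩ Bjᶜ) = (prodBernoulli w).real ((Xu \ Xv) ∩ (Eu ∩ Zᶜ)) := real_congr_of_sure hG1 cIo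
    rw [e, indep_far_near w R (determinedBy_union_sdiff dXu dXv).2 (dEu.inter dZc)]
    have h1 : (prodBernoulli w).real (Eu ∩ Zᶜ) ≤ (prodBernoulli w).real Eu * (1 - ζ) := real_inter_compl_le_of_upper w hEu_up hZ_up
    have h2 : (prodBernoulli w).real Eu ≤ ℓ := measureReal_mono hEuEb
    have h3 : (prodBernoulli w).real Eu * (1 - ζ) ≤ ℓ * (1 - ζ) := mul_le_mul_of_nonneg_right h2 (by linarith)
    nlinarith
  have hPjo : (prodBernoulli w).real (A ∩ Bj ∩ Biᶜ) ≤ β₂ * (1 - ζ) * ℓ := by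
    have e : (prodBernoulli w).real (A ∩ Bj ∩ Biᶜ) = (prodBernoulli w).real ((Xv \ Xu) ∩ (Ev ∩ Zᶜ)) := real_congr_of_sure hG1 cJo
    rw [e, indep_far_near w R (determinedBy_union_sdiff dXv dXu).2 (dEv.inter dZc)]
    have h1 : (prodBernoulli w).real (Ev ∩ Zᶜ) ≤ (prodBernoulli w).real Ev * (1 - ζ) := real_inter_compl_le_of_upper w hEv_up hZ_up
    have h2 : (prodBernoulli w).real Ev ≤ ℓ := measureReal_mono hEvEb
    have h3 : (prodBernoulli w).real Ev * (1 - ζ) ≤ ℓ * (1 - ζ) := mul_le_mul_of_nonneg_right h2 (by linarith)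
    nlinarith
  have hPnone : (prodBernoulli w).real (A ∩ Biᶜ ∩ Bjᶜ) = 0 := by
    rw [real_congr_of_sure hG1 cNone, measureReal_empty]
  -- bookkeeping: P(A ∩ B_i) = both + io, P(A ∩ B_j) = both + jo, P(A) = both + io + jo + 0
  have sAi : (prodBernoulli w).real (A ∩ Bi) = (prodBernoulli w).real (A ∩ Bi ∩ Bj) + (prodBernoulli w).real (A ∩ Bi ∩ Bjᶜ) :=
    real_split w (A ∩ Bi) Bj
  have sAj : (prodBernoulli w).real (A ∩ Bj) = (prodBernoulli w).real (A ∩ Bi ∩ Bj) + (prodBernoulli w).real (A ∩ Bj ∩ Biᶜ) := by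
    have e1 : A ∩ Bj ∩ Bi = A ∩ Bi ∩ Bj := by
      ext ω; exact ⟨fun h => ⟨⟨h.1.1, h.2⟩, h.1.2⟩, fun h => ⟨⟨h.1.1, h.2⟩, h.1.2⟩⟩
    rw [real_split w (A ∩ Bj) Bi, e1]
  have sA : (prodBernoulli w).real A = (prodBernoulli w).real (A ∩ Bi ∩ Bj) + (prodBernoulli w).real (A ∩ Bi ∩ Bjᶜ)
      + (prodBernoulli w).real (A ∩ Bj ∩ Biᶜ) + (prodBernoulli w).real (A ∩ Biᶜ ∩ Bjᶜ) := by
    have e1 : A ∩ Biᶜ ∩ Bj = A ∩ Bj ∩ Biᶜ := by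
      ext ω; exact ⟨fun h => ⟨⟨h.1.1, h.2⟩, h.1.2⟩, fun h => ⟨⟨h.1.1, h.2⟩, h.1.2⟩⟩
    rw [real_split w A Bi, sAi, real_split w (A ∩ Biᶜ) Bj, e1]
    ring
  rw [sAi, sAj, sA, hPnone]
  have := targetCut_core hα0 hβ₁0 hβ₂0 hsum hζ0 hζ1 hℓ0 hqi hqj hqij rfl (by nlinarith [hEW0]) hPb hPio hPjo
  nlinarith [this, hPb, hPio, hPjo, hEW0]

/-- **(P_k) behind a target cut.**  In the setting of `wdom_targetCut`, for every vertex `k ∉ R` (a vertex separated from the root by the two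
targets) the (P_k) margin is nonnegative:
`2q_{ijk} + 2q_iq_jq_k − q_j q_{ik} − q_i q_{jk} − 2q_k q_{ij} ≥ 0`, i.e. `Cov(1{s↔k}, W_{ij}) ≥ 0`. [this work] -/
theorem pk_of_targetCut (w : Sym2 (Fin n) → unitInterval) (R : Set (Fin n)) {s i j k : Fin n}
    (hs : s ∈ R) (hi : i ∉ R) (hj : j ∉ R) (hk : k ∉ R)
    (hw : ∀ x ∈ R, ∀ z, z ∉ R → z ≠ i → z ≠ j → w s(x, z) = 0) :
    0 ≤ 2 * (prodBernoulli w).real (openConn s i ∩ openConn s j ∩ openConn s k)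
        + 2 * ((prodBernoulli w).real (openConn s i) * (prodBernoulli w).real (openConn s j)
                 * (prodBernoulli w).real (openConn s k))
        - (prodBernoulli w).real (openConn s i) * (prodBernoulli w).real (openConn s j ∩ openConn s k)
        - (prodBernoulli w).real (openConn s j) * (prodBernoulli w).real (openConn s i ∩ openConn s k)
        - 2 * ((prodBernoulli w).real (openConn s k) * (prodBernoulli w).real (openConn s i ∩ openConn s j)) := by
  have h := wdom_targetCut w R hs hi hj hw {S : Set (Fin n) | k ∈ S} (fun S T hS hST => hST hS)
  have hA : {ω : BondConfig (Fin n) | openCluster ω s ∩ Rᶜ ∈ {S : Set (Fin n) | k ∈ S}} = openConn s k := by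
    ext ω; exact ⟨fun h => h.1, fun h => ⟨h, hk⟩⟩
  have e1 : openConn s k ∩ openConn s i ∩ openConn s j = (openConn s i ∩ openConn s j ∩ openConn s k : Set (BondConfig (Fin n))) := by
    ext ω; exact ⟨fun h => ⟨⟨h.1.2, h.2⟩, h.1.1⟩, fun h => ⟨⟨h.2, h.1.1⟩, h.1.2⟩⟩
  rw [hA, e1, Set.inter_comm (openConn s k) (openConn s i), Set.inter_comm (openConn s k) (openConn s j)] at h
  linarith

/-- **The increasing star behind a target cut.**  In the setting of `wdom_targetCut`, Sahi's `E₃({s↔i},{s↔j},{s↔k}) ≥ 0` for every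
`k ∉ R` (via `incStar_nonneg_of_pk`). [this work] -/
theorem incStar_nonneg_of_targetCut (w : Sym2 (Fin n) → unitInterval) (R : Set (Fin n)) {s i j k : Fin n}
    (hs : s ∈ R) (hi : i ∉ R) (hj : j ∉ R) (hk : k ∉ R)
    (hw : ∀ x ∈ R, ∀ z, z ∉ R → z ≠ i → z ≠ j → w s(x, z) = 0) :
    0 ≤ sahiE3 (prodBernoulli w) (openConn s i) (openConn s j) (openConn s k) :=
  incStar_nonneg_of_pk w s i j k (pk_of_targetCut w R hs hi hj hk hw)

end IncStar

end Summit.CriticalPhenomena.PercolationContinuityZ3.Theorems
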